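import Literature.NumberTheory.GaloisRepresentations.LubinTateColemanLogDerivLimit
import Literature.NumberTheory.GaloisRepresentations.LubinTateColemanNormClosed
import Literature.NumberTheory.GaloisRepresentations.LubinTateColemanUnitsLogDeriv
import Literature.NumberTheory.GaloisRepresentations.LubinTateColemanEquiv
import Literature.NumberTheory.GaloisRepresentations.CyclotomicCharacterArtinNormProofs
import HarnessLib

/-!
# `δ : 𝒰 → 𝓔_π` is onto at `q = 2` (de Shalit I §3.12 Corollary), in particular over `ℚ₂`

De Shalit, *Iwasawa theory of elliptic curves with complex multiplication* (1987), Ch. I §3.12 Corollary: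
for a Lubin–Tate group `F_f` of height one, Coleman's logarithmic derivative `δβ = ω_F · g_β'/g_β` maps the
norm-coherent units `𝒰` of the tower ONTO `𝓔_π = {h : 𝒮h = πh}` (kernel `μ_{q-1}`).  This file assembles the
`q = 2` case for `f = πX + X^q` over `𝒪[F]` from

* `exists_logDeriv_eq_of_colemanTrace_eq` (`LubinTateColemanLogDerivLimit`): `𝒮h = πh ⟹ h = δG` with `G` the
  `(π, X)`-adic limit of `𝒩`-invariant principal units `G_N`;
* `colemanNorm_eq_self_of_forall_sub_mem` (`LubinTateColemanNormClosed`): such a limit is `𝒩`-invariant;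
* Coleman's bijection `𝒰 ≅ ℳ_f` (`NormCoherentUnits.ofSeries`, `LubinTateColemanEquiv`).

Results:

* ★★★ `exists_colemanNorm_eq_logDeriv_eq` — `|𝓀_F| = 2`, `π ≡ m₁ (mod π²)` for some `m₁ ∈ ℕ`:
  `𝒮h = πh ⟹ ∃ G ∈ ℳ_f`, `G(0) ≡ 1 (π)`, `δG = h`; `exists_colemanNorm_eq_logDeriv_eq_iff` (`δ(ℳ_f) = 𝓔_π`).
* ★★★ `NormCoherentUnits.exists_logDeriv_eq` / `exists_logDeriv_eq_iff` — the same on `𝒰` (`δ(𝒰) = 𝓔_π`).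
* ★★ `eq_of_colemanNorm_eq_of_logDeriv_eq`, `NormCoherentUnits.logDeriv_injective` (characteristic `0`) — `δ` is
  injective on `ℳ_f` / `𝒰` at `q = 2` (`ker δ = μ_{q−1}(F) = 1`); `existsUnique_colemanNorm_eq_logDeriv_eq_iff`,
  `NormCoherentUnits.existsUnique_logDeriv_eq_iff` — **`δ : 𝒰 ≅ 𝓔_π` is a bijection**.
* ★★★ `PadicTwo.exists_normCoherentUnits_logDeriv_eq` (+ `_iff`, `PadicTwo.exists_colemanNorm_eq_logDeriv_eq`) —
  **`F = ℚ₂`, `π = 2`, `f = 2X + X² = (1+X)² − 1`** (the multiplicative group, tower `ℚ₂(ζ_{2^∞})`):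
  `δ(𝒰) = 𝓔_2 = {h ∈ ℤ₂⟦X⟧ : 𝒮h = 2h}` unconditionally (`residueFieldCard ℚ_[2] = 2`, `2 ≡ 2 (mod 4)`), and
  `PadicTwo.existsUnique_normCoherentUnits_logDeriv_eq_iff` — **`δ : 𝒰 ≅ 𝓔_2` bijectively**.

The hypothesis `π ≡ m₁ (mod π²)`, `m₁ ∈ ℕ`, is what the `q = 2` density argument
(`exists_colemanNorm_eq_sub_logDeriv_mem_pow`) uses to raise `𝒩`-invariant units to `π`-adically
convergent integer powers; it holds for `ℚ₂` with any uniformizer `≡ 2 (mod 4)`. General `q` (de Shalit's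
twist to `𝔾̂_m` over `𝒪̂_nr`) is not treated here.  Everything is proved (0 sorry).

## References

* E. de Shalit, *Iwasawa theory of elliptic curves with complex multiplication* (1987), Ch. I §3.12. [deShalit1987]
* R. Coleman, *Division values in local fields*, Invent. Math. 53 (1979), Thm. A and §IV. [Coleman1979]
-/

noncomputable section

open scoped PowerSeries.WithPiTopology

namespace Literature.NumberTheory.GaloisRepresentations

section LocalFieldSurjTwo

open GaloisRepresentations.IsNonarchimedeanLocalField LubinTate ValuativeRel

variable (F : Type*) [Field F] [ValuativeRel F] [TopologicalSpace F] [IsNonarchimedeanLocalField F]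

attribute [local instance] ltNormUniformSpace ltNormIsUniformAddGroup rk1 nF nE fintypeResidueField

variable {F}
variable {π : 𝒪[F]} (hπ : (valuation F).IsUniformizer (π : F)) (n : ℕ)

/-- ★★★ **De Shalit I §3.12 Corollary at `q = 2`: `δ : ℳ_f¹ → 𝓔_π` is onto.** If `|𝓀_F| = 2` and `π ≡ m₁ (mod π²)`
for some `m₁ ∈ ℕ` (e.g. `F = ℚ₂`, `π = 2`), then every `h ∈ 𝒪[F]⟦X⟧` with `𝒮h = π h` is `δG = ω_F · G'/G`
for an `𝒩`-invariant unit `G` with `G(0) ≡ 1 (mod π)`. [cite: deShalit1987, Ch. I §3.12 Corollary] -/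
theorem exists_colemanNorm_eq_logDeriv_eq (hq : residueFieldCard F = 2)
    (hm : ∃ m₁ : ℕ, LTCoeff.of F π ^ 2 ∣ LTCoeff.of F π - m₁)
    (h : PowerSeries (LTCoeff F)) (hh : colemanTrace hπ n h = PowerSeries.C (LTCoeff.of F π) * h) :
    ∃ G : (PowerSeries (LTCoeff F))ˣ, colemanNorm hπ n (G : PowerSeries (LTCoeff F)) = G ∧
      PowerSeries.constantCoeff (G : PowerSeries (LTCoeff F)) - 1 ∈ Ideal.span {LTCoeff.of F π} ∧
      logDeriv hπ G = h := by
  obtain ⟨m₁, hm₁⟩ := hm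
  obtain ⟨G, hG1, hG2, hG3⟩ := exists_logDeriv_eq_of_colemanTrace_eq hπ n hq hm₁ h hh
  refine ⟨G, colemanNorm_eq_self_of_forall_sub_mem hπ n _ fun N =>
    ⟨_, (approxSeq hπ n hq hm₁ hh N).norm_eq, fun k => (mem_adicFilt.mp (hG3 N)) k⟩, hG1, hG2⟩

/-- ★★ **`δ(ℳ_f) = 𝓔_π` at `q = 2`** (as an `iff`): `h = δG` for some `𝒩`-invariant unit `G` **iff** `𝒮h = πh`.
[cite: deShalit1987, Ch. I §3.12 Corollary] -/
theorem exists_colemanNorm_eq_logDeriv_eq_iff (hq : residueFieldCard F = 2)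
    (hm : ∃ m₁ : ℕ, LTCoeff.of F π ^ 2 ∣ LTCoeff.of F π - m₁) (h : PowerSeries (LTCoeff F)) :
    (∃ G : (PowerSeries (LTCoeff F))ˣ, colemanNorm hπ n (G : PowerSeries (LTCoeff F)) = G ∧ logDeriv hπ G = h) ↔
      colemanTrace hπ n h = PowerSeries.C (LTCoeff.of F π) * h := by
  constructor
  · rintro ⟨G, hG, rfl⟩
    exact colemanTrace_logDeriv_of_colemanNorm_eq hπ n G hG
  · intro hh
    obtain ⟨G, hG1, -, hG3⟩ := exists_colemanNorm_eq_logDeriv_eq hπ n hq hm h hh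
    exact ⟨G, hG1, hG3⟩

/-- ★★ **`δ` is injective on `ℳ_f` at `q = 2`** (characteristic `0`): two `𝒩`-invariant units with the same
logarithmic derivative are equal — their quotient is a constant `c` with `c^q = c` (`𝒩c = c^q`), and
`μ_{q−1}(F) = 1` for `q = 2`. [cite: deShalit1987, Ch. I §3.12 Corollary] -/
theorem eq_of_colemanNorm_eq_of_logDeriv_eq [CharZero F] (hq : residueFieldCard F = 2)
    (g g' : (PowerSeries (LTCoeff F))ˣ) (hg : colemanNorm hπ n (g : PowerSeries (LTCoeff F)) = g)
    (hg' : colemanNorm hπ n (g' : PowerSeries (LTCoeff F)) = g') (hδ : logDeriv hπ g = logDeriv hπ g') :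
    g = g' := by
  set u : (PowerSeries (LTCoeff F))ˣ := g' * g⁻¹ with hu
  have hug : u * g = g' := by rw [hu, inv_mul_cancel_right]
  have hδu : logDeriv hπ u = 0 := by
    have h1 : logDeriv hπ g' = logDeriv hπ u + logDeriv hπ g' := by
      conv_lhs => rw [← hug, logDeriv_mul, hδ]
    exact add_right_cancel (h1.symm.trans (zero_add _).symm)
  have hinv : colemanNorm hπ n ((g⁻¹ : (PowerSeries (LTCoeff F))ˣ) : PowerSeries (LTCoeff F)) =
      ((g⁻¹ : (PowerSeries (LTCoeff F))ˣ) : PowerSeries (LTCoeff F)) := by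
    have h1 := colemanNorm_mul hπ n (g : PowerSeries (LTCoeff F)) ((g⁻¹ : (PowerSeries (LTCoeff F))ˣ) : _)
    rw [Units.mul_inv, colemanNorm_one, hg] at h1
    calc colemanNorm hπ n ((g⁻¹ : (PowerSeries (LTCoeff F))ˣ) : PowerSeries (LTCoeff F))
        = ((g⁻¹ : (PowerSeries (LTCoeff F))ˣ) : PowerSeries (LTCoeff F)) *
            ((g : PowerSeries (LTCoeff F)) * colemanNorm hπ n ((g⁻¹ : (PowerSeries (LTCoeff F))ˣ) : _)) := by
          rw [← mul_assoc, Units.inv_mul, one_mul]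
      _ = _ := by rw [← h1, mul_one]
  have hNu : colemanNorm hπ n (u : PowerSeries (LTCoeff F)) = u := by
    rw [hu, Units.val_mul, colemanNorm_mul, hg', hinv]
  obtain ⟨huC, hc⟩ := eq_C_of_colemanNorm_eq_of_logDeriv_eq_zero hπ n u hNu hδu
  rw [hq] at hc
  have hcu : IsUnit (PowerSeries.constantCoeff (u : PowerSeries (LTCoeff F))) := u.isUnit.map _
  have hc1 : PowerSeries.constantCoeff (u : PowerSeries (LTCoeff F)) = 1 :=
    hcu.mul_left_cancel (by rw [mul_one, ← sq, hc])
  have hu1 : u = 1 := Units.ext (by rw [huC, hc1, map_one, Units.val_one])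
  rw [hu, mul_inv_eq_one] at hu1
  exact hu1.symm

/-- ★★ **`δ(ℳ_f) = 𝓔_π` bijectively at `q = 2`** (characteristic `0`): `𝒮h = πh` iff `h = δG` for a UNIQUE
`𝒩`-invariant unit `G`. [cite: deShalit1987, Ch. I §3.12 Corollary] -/
theorem existsUnique_colemanNorm_eq_logDeriv_eq_iff [CharZero F] (hq : residueFieldCard F = 2)
    (hm : ∃ m₁ : ℕ, LTCoeff.of F π ^ 2 ∣ LTCoeff.of F π - m₁) (h : PowerSeries (LTCoeff F)) :
    (∃! G : (PowerSeries (LTCoeff F))ˣ, colemanNorm hπ n (G : PowerSeries (LTCoeff F)) = G ∧ logDeriv hπ G = h) ↔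
      colemanTrace hπ n h = PowerSeries.C (LTCoeff.of F π) * h := by
  constructor
  · rintro ⟨G, ⟨hG, rfl⟩, -⟩
    exact colemanTrace_logDeriv_of_colemanNorm_eq hπ n G hG
  · intro hh
    obtain ⟨G, hG1, -, hG3⟩ := exists_colemanNorm_eq_logDeriv_eq hπ n hq hm h hh
    exact ⟨G, ⟨hG1, hG3⟩, fun G' hG' =>
      eq_of_colemanNorm_eq_of_logDeriv_eq hπ n hq G' G hG'.1 hG1 (hG'.2.trans hG3.symm)⟩

namespace NormCoherentUnits

/-- ★★★ **`δ : 𝒰 → 𝓔_π` is onto at `q = 2`**: every `h` with `𝒮h = πh` is `δβ` for a norm-coherent unit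
sequence `β = (G(ω_{m+1}))_m` of the Lubin–Tate tower (Coleman's bijection `𝒰 ≅ ℳ_f`, `NormCoherentUnits.ofSeries`).
[cite: deShalit1987, Ch. I §3.12 Corollary] -/
theorem exists_logDeriv_eq (hq : residueFieldCard F = 2) (hm : ∃ m₁ : ℕ, LTCoeff.of F π ^ 2 ∣ LTCoeff.of F π - m₁)
    (h : PowerSeries (LTCoeff F)) (hh : colemanTrace hπ n h = PowerSeries.C (LTCoeff.of F π) * h) :
    ∃ β : NormCoherentUnits hπ, β.logDeriv = h := by
  obtain ⟨G, hG1, -, hG3⟩ := exists_colemanNorm_eq_logDeriv_eq hπ n hq hm h hh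
  have hG0 : colemanNorm hπ 0 (G : PowerSeries (LTCoeff F)) = G := by
    rw [colemanNorm_level_eq hπ 0 n]; exact hG1
  have hu : IsUnit (PowerSeries.constantCoeff (G : PowerSeries (LTCoeff F))) := G.isUnit.map _
  refine ⟨NormCoherentUnits.ofSeries hπ (G : PowerSeries (LTCoeff F)) hG0 hu, ?_⟩
  rw [logDeriv_def, ← hG3]
  congr 1
  exact Units.ext (by rw [coe_colemanUnit, colemanSeries_ofSeries])

/-- ★★ **`δ(𝒰) = 𝓔_π` at `q = 2`** (as an `iff`). [cite: deShalit1987, Ch. I §3.12 Corollary] -/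
theorem exists_logDeriv_eq_iff (hq : residueFieldCard F = 2) (hm : ∃ m₁ : ℕ, LTCoeff.of F π ^ 2 ∣ LTCoeff.of F π - m₁)
    (h : PowerSeries (LTCoeff F)) :
    (∃ β : NormCoherentUnits hπ, β.logDeriv = h) ↔ colemanTrace hπ n h = PowerSeries.C (LTCoeff.of F π) * h := by
  constructor
  · rintro ⟨β, rfl⟩
    exact colemanTrace_logDeriv β n
  · exact exists_logDeriv_eq hπ n hq hm h

/-- ★★ **`δ` is injective on `𝒰` at `q = 2`** (characteristic `0`; kernel `μ_{q−1}(F) = 1`).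
[cite: deShalit1987, Ch. I §3.12 Corollary] -/
theorem logDeriv_injective [CharZero F] (hq : residueFieldCard F = 2) :
    Function.Injective (NormCoherentUnits.logDeriv (hπ := hπ)) := by
  intro β β' hδ
  have hG : colemanUnit β = colemanUnit β' :=
    eq_of_colemanNorm_eq_of_logDeriv_eq hπ 0 hq (colemanUnit β) (colemanUnit β')
      (by rw [coe_colemanUnit]; exact colemanNorm_colemanSeries hπ β)
      (by rw [coe_colemanUnit]; exact colemanNorm_colemanSeries hπ β') hδ
  apply (colemanEquiv hπ).injective
  apply Subtype.ext
  rw [coe_colemanEquiv, coe_colemanEquiv, ← coe_colemanUnit, ← coe_colemanUnit, hG]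

/-- ★★★ **`δ : 𝒰 ≅ 𝓔_π` at `q = 2`** (characteristic `0`): `𝒮h = πh` iff `h = δβ` for a UNIQUE norm-coherent
unit sequence `β`. [cite: deShalit1987, Ch. I §3.12 Corollary] -/
theorem existsUnique_logDeriv_eq_iff [CharZero F] (hq : residueFieldCard F = 2)
    (hm : ∃ m₁ : ℕ, LTCoeff.of F π ^ 2 ∣ LTCoeff.of F π - m₁) (h : PowerSeries (LTCoeff F)) :
    (∃! β : NormCoherentUnits hπ, β.logDeriv = h) ↔ colemanTrace hπ n h = PowerSeries.C (LTCoeff.of F π) * h := by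
  constructor
  · rintro ⟨β, rfl, -⟩
    exact colemanTrace_logDeriv β n
  · intro hh
    obtain ⟨β, hβ⟩ := exists_logDeriv_eq hπ n hq hm h hh
    exact ⟨β, hβ, fun β' hβ' => logDeriv_injective hπ hq (hβ'.trans hβ.symm)⟩

end NormCoherentUnits

end LocalFieldSurjTwo

section PadicTwo

open GaloisRepresentations.IsNonarchimedeanLocalField LubinTate ValuativeRel

attribute [local instance] ltNormUniformSpace ltNormIsUniformAddGroup rk1 nF nE fintypeResidueField

/-- `π = 2` satisfies the congruence hypothesis `π ≡ m₁ (mod π²)` with `m₁ = 2`. [folklore] -/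
private theorem PadicTwo.exists_sq_dvd_sub :
    haveI := Padic.isNonarchimedeanLocalField_holds 2
    ∃ m₁ : ℕ, LTCoeff.of ℚ_[2] ((2 : ℕ) : 𝒪[ℚ_[2]]) ^ 2 ∣ LTCoeff.of ℚ_[2] ((2 : ℕ) : 𝒪[ℚ_[2]]) - m₁ :=
  ⟨2, by rw [map_natCast, sub_self]; exact dvd_zero _⟩

/-- ★★★ **De Shalit I §3.12 Corollary for the height-one Lubin–Tate group `f = 2X + X²` over `ℚ₂`**
(the multiplicative group in the coordinate `X = T`, `𝔾̂_m(X) = (1+X)² − 1`): every `h ∈ ℤ₂⟦X⟧` with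
`𝒮h = 2h` is Coleman's logarithmic derivative `δβ` of a norm-coherent sequence of units `β` of the tower
`ℚ₂(ζ_{2^{m+1}})`. [cite: deShalit1987, Ch. I §3.12 Corollary] -/
theorem PadicTwo.exists_normCoherentUnits_logDeriv_eq :
    haveI := Padic.isNonarchimedeanLocalField_holds 2
    ∀ (n : ℕ) (h : PowerSeries (LTCoeff ℚ_[2])),
      colemanTrace (Padic.isUniformizer_natCast 2) n h =
          PowerSeries.C (LTCoeff.of ℚ_[2] ((2 : ℕ) : 𝒪[ℚ_[2]])) * h →
        ∃ β : NormCoherentUnits (Padic.isUniformizer_natCast 2), β.logDeriv = h := by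
  haveI := Padic.isNonarchimedeanLocalField_holds 2
  intro n h hh
  exact NormCoherentUnits.exists_logDeriv_eq (Padic.isUniformizer_natCast 2) n (Padic.residueFieldCard_eq 2)
    PadicTwo.exists_sq_dvd_sub h hh

/-- ★★ **`δ(𝒰) = 𝓔_2` over `ℚ₂`** (as an `iff`): `h = δβ` for a norm-coherent unit sequence `β` iff `𝒮h = 2h`.
[cite: deShalit1987, Ch. I §3.12 Corollary] -/
theorem PadicTwo.exists_normCoherentUnits_logDeriv_eq_iff :
    haveI := Padic.isNonarchimedeanLocalField_holds 2
    ∀ (n : ℕ) (h : PowerSeries (LTCoeff ℚ_[2])),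
      (∃ β : NormCoherentUnits (Padic.isUniformizer_natCast 2), β.logDeriv = h) ↔
        colemanTrace (Padic.isUniformizer_natCast 2) n h =
          PowerSeries.C (LTCoeff.of ℚ_[2] ((2 : ℕ) : 𝒪[ℚ_[2]])) * h := by
  haveI := Padic.isNonarchimedeanLocalField_holds 2
  intro n h
  exact NormCoherentUnits.exists_logDeriv_eq_iff (Padic.isUniformizer_natCast 2) n (Padic.residueFieldCard_eq 2)
    PadicTwo.exists_sq_dvd_sub h

/-- ★★ **`δ(ℳ_f¹) = 𝓔_2` over `ℚ₂` with a principal `𝒩`-invariant unit.** [cite: deShalit1987, Ch. I §3.12 Corollary] -/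
theorem PadicTwo.exists_colemanNorm_eq_logDeriv_eq :
    haveI := Padic.isNonarchimedeanLocalField_holds 2
    ∀ (n : ℕ) (h : PowerSeries (LTCoeff ℚ_[2])),
      colemanTrace (Padic.isUniformizer_natCast 2) n h =
          PowerSeries.C (LTCoeff.of ℚ_[2] ((2 : ℕ) : 𝒪[ℚ_[2]])) * h →
        ∃ G : (PowerSeries (LTCoeff ℚ_[2]))ˣ,
          colemanNorm (Padic.isUniformizer_natCast 2) n (G : PowerSeries (LTCoeff ℚ_[2])) = G ∧
          PowerSeries.constantCoeff (G : PowerSeries (LTCoeff ℚ_[2])) - 1 ∈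
            Ideal.span {LTCoeff.of ℚ_[2] ((2 : ℕ) : 𝒪[ℚ_[2]])} ∧
          logDeriv (Padic.isUniformizer_natCast 2) G = h := by
  haveI := Padic.isNonarchimedeanLocalField_holds 2
  intro n h hh
  exact Literature.NumberTheory.GaloisRepresentations.exists_colemanNorm_eq_logDeriv_eq
    (Padic.isUniformizer_natCast 2) n (Padic.residueFieldCard_eq 2) PadicTwo.exists_sq_dvd_sub h hh

/-- ★★★ **`δ : 𝒰 ≅ 𝓔_2` over `ℚ₂`**: for the tower `ℚ₂(ζ_{2^{m+1}})` of `f = 2X + X²`, `h ∈ ℤ₂⟦X⟧` satisfies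
`𝒮h = 2h` iff `h = δβ` for a UNIQUE norm-coherent sequence of units `β` (Coleman–de Shalit, `q = 2`, where
`ker δ = μ_{q−1} = 1`). [cite: deShalit1987, Ch. I §3.12 Corollary] -/
theorem PadicTwo.existsUnique_normCoherentUnits_logDeriv_eq_iff :
    haveI := Padic.isNonarchimedeanLocalField_holds 2
    ∀ (n : ℕ) (h : PowerSeries (LTCoeff ℚ_[2])),
      (∃! β : NormCoherentUnits (Padic.isUniformizer_natCast 2), β.logDeriv = h) ↔
        colemanTrace (Padic.isUniformizer_natCast 2) n h =
          PowerSeries.C (LTCoeff.of ℚ_[2] ((2 : ℕ) : 𝒪[ℚ_[2]])) * h := by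
  haveI := Padic.isNonarchimedeanLocalField_holds 2
  intro n h
  exact NormCoherentUnits.existsUnique_logDeriv_eq_iff (Padic.isUniformizer_natCast 2) n
    (Padic.residueFieldCard_eq 2) PadicTwo.exists_sq_dvd_sub h

end PadicTwo

end Literature.NumberTheory.GaloisRepresentations

/-! ## Appendix: the congruence hypothesis `π ≡ m₁ (mod π²)` at `q = 2`; every uniformizer of `ℚ₂` -/

namespace Literature.NumberTheory.GaloisRepresentations

section UnramifiedTwo

open GaloisRepresentations.IsNonarchimedeanLocalField LubinTate ValuativeRel

variable (F : Type*) [Field F] [ValuativeRel F] [TopologicalSpace F] [IsNonarchimedeanLocalField F]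

attribute [local instance] ltNormUniformSpace ltNormIsUniformAddGroup rk1 nF nE fintypeResidueField

variable {F}
variable {π : 𝒪[F]} (hπ : (valuation F).IsUniformizer (π : F)) (n : ℕ)

include hπ in
/-- **At `q = 2`: `2 ∉ (π²) ⟹ π ≡ 2 (mod π²)`.** Writing `2 = π u` (`exists_two_eq_pi_mul`), `u` is a unit, hence
`≡ 1 (mod π)` as `|𝓀_F| = 2`; so the congruence hypothesis of the surjectivity theorems holds with `m₁ = 2`
whenever `e(F | ℚ₂) = 1`. [cite: deShalit1987, Ch. I §3.12] -/
theorem sq_dvd_sub_two_of_two_not_mem (hq : residueFieldCard F = 2)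
    (h4 : (2 : LTCoeff F) ∉ Ideal.span {LTCoeff.of F π ^ 2}) :
    LTCoeff.of F π ^ 2 ∣ LTCoeff.of F π - 2 := by
  obtain ⟨u, hu⟩ := exists_two_eq_pi_mul hπ hq
  have hu1 : u ∉ Ideal.span {LTCoeff.of F π} := by
    intro hmem
    obtain ⟨t, rfl⟩ := Ideal.mem_span_singleton.mp hmem
    exact h4 (Ideal.mem_span_singleton.mpr ⟨t, by rw [hu]; ring⟩)
  have hres : IsLocalRing.residue 𝒪[F] ((LTCoeff.of F).symm u) ≠ 0 := fun h0 =>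
    hu1 ((residue_eq_zero_iff_mem hπ u).mp h0)
  have hres1 : IsLocalRing.residue 𝒪[F] ((LTCoeff.of F).symm u) = 1 := by
    obtain ⟨y, -, hy⟩ := (Nat.card_eq_two_iff' (0 : 𝓀[F])).mp hq
    exact (hy _ hres).trans (hy 1 one_ne_zero).symm
  have hu2 : u - 1 ∈ Ideal.span {LTCoeff.of F π} := by
    rw [← residue_eq_zero_iff_mem hπ, map_sub, map_sub, map_one, map_one, hres1, sub_self]
  obtain ⟨t, ht⟩ := Ideal.mem_span_singleton.mp hu2
  exact ⟨-t, by linear_combination (-(LTCoeff.of F π)) * ht - hu⟩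

include hπ in
/-- At `q = 2` with `2 ∉ (π²)`: `∃ m₁ ∈ ℕ, π² ∣ π − m₁` (namely `m₁ = 2`). [cite: deShalit1987, Ch. I §3.12] -/
theorem exists_sq_dvd_sub_of_two_not_mem (hq : residueFieldCard F = 2)
    (h4 : (2 : LTCoeff F) ∉ Ideal.span {LTCoeff.of F π ^ 2}) :
    ∃ m₁ : ℕ, LTCoeff.of F π ^ 2 ∣ LTCoeff.of F π - m₁ :=
  ⟨2, by rw [Nat.cast_ofNat]; exact sq_dvd_sub_two_of_two_not_mem hπ hq h4⟩

/-- ★★★ **`δ : 𝒰 ≅ 𝓔_π` at `q = 2`, `e(F | ℚ₂) = 1`** (characteristic `0`, `2 ∉ (π²)`): `𝒮h = πh` iff `h = δβ`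
for a unique norm-coherent unit sequence `β`. [cite: deShalit1987, Ch. I §3.12 Corollary] -/
theorem NormCoherentUnits.existsUnique_logDeriv_eq_iff_of_two_not_mem [CharZero F] (hq : residueFieldCard F = 2)
    (h4 : (2 : LTCoeff F) ∉ Ideal.span {LTCoeff.of F π ^ 2}) (h : PowerSeries (LTCoeff F)) :
    (∃! β : NormCoherentUnits hπ, β.logDeriv = h) ↔ colemanTrace hπ n h = PowerSeries.C (LTCoeff.of F π) * h :=
  NormCoherentUnits.existsUnique_logDeriv_eq_iff hπ n hq (exists_sq_dvd_sub_of_two_not_mem hπ hq h4) h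

end UnramifiedTwo

section PadicTwoAnyUniformizer

open GaloisRepresentations.IsNonarchimedeanLocalField LubinTate ValuativeRel

attribute [local instance] ltNormUniformSpace ltNormIsUniformAddGroup rk1 nF nE fintypeResidueField

/-- Over `ℚ₂`, `2 ∉ (π²)` for EVERY uniformizer `π` (`v(2) = v(π) > v(π)²`). [folklore] -/
private theorem PadicTwo.two_not_mem_span_sq :
    haveI := Padic.isNonarchimedeanLocalField_holds 2
    ∀ {π : 𝒪[ℚ_[2]]}, (valuation ℚ_[2]).IsUniformizer (π : ℚ_[2]) →
      (2 : LTCoeff ℚ_[2]) ∉ Ideal.span {LTCoeff.of ℚ_[2] π ^ 2} := by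
  haveI := Padic.isNonarchimedeanLocalField_holds 2
  intro π hπ hmem
  obtain ⟨t, ht⟩ := Ideal.mem_span_singleton.mp hmem
  set t' : 𝒪[ℚ_[2]] := (LTCoeff.of ℚ_[2]).symm t with ht'
  have h1 : (2 : 𝒪[ℚ_[2]]) = π ^ 2 * t' := by
    apply (LTCoeff.of ℚ_[2]).injective
    rw [map_ofNat, map_mul, map_pow, ht', RingEquiv.apply_symm_apply]
    exact ht
  have h2 : valuation ℚ_[2] ((2 : 𝒪[ℚ_[2]]) : ℚ_[2]) = unifValue ℚ_[2] := by
    have h := Padic.isUniformizer_natCast 2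
    rw [isUniformizer_iff_valuation_eq_unifValue] at h
    rw [← h]
    norm_cast
  have hπv : valuation ℚ_[2] (π : ℚ_[2]) = unifValue ℚ_[2] := hπ
  have htv : valuation ℚ_[2] (t' : ℚ_[2]) ≤ 1 := t'.2
  have h3 : unifValue ℚ_[2] ≤ unifValue ℚ_[2] * unifValue ℚ_[2] := by
    calc unifValue ℚ_[2] = valuation ℚ_[2] ((2 : 𝒪[ℚ_[2]]) : ℚ_[2]) := by rw [h2]
      _ = valuation ℚ_[2] (π : ℚ_[2]) ^ 2 * valuation ℚ_[2] (t' : ℚ_[2]) := by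
          rw [h1]; push_cast; rw [map_mul, map_pow]
      _ ≤ unifValue ℚ_[2] ^ 2 * 1 := mul_le_mul' (by rw [hπv]) htv
      _ = unifValue ℚ_[2] * unifValue ℚ_[2] := by rw [mul_one, sq]
  have h4 : (1 : ValueGroupWithZero ℚ_[2]) ≤ unifValue ℚ_[2] := one_le_of_le_mul_right₀ (unifValue_pos ℚ_[2]) h3
  exact absurd (unifValue_lt_one ℚ_[2]) (not_lt.mpr h4)

/-- **Every uniformizer `π` of `ℚ₂` satisfies `π ≡ 2 (mod π²)`** (so the `q = 2` surjectivity theorems apply to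
the Lubin–Tate group `πX + X²` of ANY uniformizer `π` of `ℚ₂`, e.g. `π = ψ_E(𝔭)` for a CM curve at a split `2`).
[cite: deShalit1987, Ch. I §3.12] -/
theorem PadicTwo.exists_sq_dvd_sub_of_isUniformizer :
    haveI := Padic.isNonarchimedeanLocalField_holds 2
    ∀ {π : 𝒪[ℚ_[2]]}, (valuation ℚ_[2]).IsUniformizer (π : ℚ_[2]) →
      ∃ m₁ : ℕ, LTCoeff.of ℚ_[2] π ^ 2 ∣ LTCoeff.of ℚ_[2] π - m₁ := by
  haveI := Padic.isNonarchimedeanLocalField_holds 2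
  intro π hπ
  exact exists_sq_dvd_sub_of_two_not_mem hπ (Padic.residueFieldCard_eq 2) (PadicTwo.two_not_mem_span_sq hπ)

/-- ★★★ **`δ : 𝒰 ≅ 𝓔_π` over `ℚ₂` for EVERY uniformizer `π`** (tower of `f = πX + X²`, i.e. `ℚ₂(F_f[π^{m+1}])`):
`h ∈ ℤ₂⟦X⟧` satisfies `𝒮h = πh` iff `h = δβ` for a unique norm-coherent sequence of units `β`.
[cite: deShalit1987, Ch. I §3.12 Corollary] -/
theorem PadicTwo.existsUnique_normCoherentUnits_logDeriv_eq_iff_of_isUniformizer :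
    haveI := Padic.isNonarchimedeanLocalField_holds 2
    ∀ {π : 𝒪[ℚ_[2]]} (hπ : (valuation ℚ_[2]).IsUniformizer (π : ℚ_[2])) (n : ℕ) (h : PowerSeries (LTCoeff ℚ_[2])),
      (∃! β : NormCoherentUnits hπ, β.logDeriv = h) ↔
        colemanTrace hπ n h = PowerSeries.C (LTCoeff.of ℚ_[2] π) * h := by
  haveI := Padic.isNonarchimedeanLocalField_holds 2
  intro π hπ n h
  exact NormCoherentUnits.existsUnique_logDeriv_eq_iff hπ n (Padic.residueFieldCard_eq 2)
    (PadicTwo.exists_sq_dvd_sub_of_isUniformizer hπ) h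

/-- ★★ **`δ(ℳ_f¹) = 𝓔_π` over `ℚ₂` for every uniformizer `π`**, with a principal `𝒩`-invariant unit.
[cite: deShalit1987, Ch. I §3.12 Corollary] -/
theorem PadicTwo.exists_colemanNorm_eq_logDeriv_eq_of_isUniformizer :
    haveI := Padic.isNonarchimedeanLocalField_holds 2
    ∀ {π : 𝒪[ℚ_[2]]} (hπ : (valuation ℚ_[2]).IsUniformizer (π : ℚ_[2])) (n : ℕ) (h : PowerSeries (LTCoeff ℚ_[2])),
      colemanTrace hπ n h = PowerSeries.C (LTCoeff.of ℚ_[2] π) * h →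
        ∃ G : (PowerSeries (LTCoeff ℚ_[2]))ˣ, colemanNorm hπ n (G : PowerSeries (LTCoeff ℚ_[2])) = G ∧
          PowerSeries.constantCoeff (G : PowerSeries (LTCoeff ℚ_[2])) - 1 ∈ Ideal.span {LTCoeff.of ℚ_[2] π} ∧
          logDeriv hπ G = h := by
  haveI := Padic.isNonarchimedeanLocalField_holds 2
  intro π hπ n h hh
  exact Literature.NumberTheory.GaloisRepresentations.exists_colemanNorm_eq_logDeriv_eq hπ n
    (Padic.residueFieldCard_eq 2) (PadicTwo.exists_sq_dvd_sub_of_isUniformizer hπ) h hh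

end PadicTwoAnyUniformizer

end Literature.NumberTheory.GaloisRepresentations
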